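/-
Copyright: seat `ym-line-cbag-p2` (prover-ym-line-cbag-p2-g2-0), route `ColdBoxAllGroups`, crux `BulkAllGroups`
(stmt-QuantumFields-22255), line `dlr-chessboard-G` (skeleton `Cruxes/BulkAllGroups/Lines/birth.lean` v5).
-/
import Summits.QuantumFields.YangMills.Theorems.ColdBoxAllGroupsOneScaleDefs
import Summits.QuantumFields.YangMills.Theorems.WeakCouplingRatesColdBoxOneScaleDatumDefs
import Summits.QuantumFields.YangMills.Theorems.WeakCouplingRatesColdBoxDirichletShiftedMean

/-!
# Crux `BulkAllGroups` (stmt-QuantumFields-22255), stubs `stub_kernelCovExpansionG` / `stub_kernelMeanExpansionG`: the OBJECTS of the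
# one-scale expansion WITH AN EXTERIOR DATUM in the exponential chart of a compact group — ϑ-twins of `…ColdBoxAllGroupsOneScaleDefs`

`G`-generic port of `Theorems/WeakCouplingRatesColdBoxOneScaleDatumDefs.lean` (the `SU(2)` ϑ-datum pass of the proved crux
`BulkDominatesColdBoxW`: gnomonic chart, three colours, scale `√(2β)`), in the vocabulary of the sibling crux's flat one-scale objects
`Theorems/ColdBoxAllGroupsOneScaleDefs.lean` (`coldGoodSetG`, `chartCfgE`, `TSpaceD`, `gaussD`, `qObsD`, `unscaleTE`, `cfgTE`, `goodTE`, `tiltWE`;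
exponential chart `ψ = expChart ρ : ℝ^D → G`, `D = dimE ρ`, scale `√β`: `β·cost_p ≈ ½Σ_c s_c(p)²`).  The DLR box kernel `boxKernelG ρ β H W` with
a SMALL EXTERIOR DATUM `W` has, off the cold box `Λ = boxEdges 4 (2H+1)`, chart points `W e = ψ(ϑ_e)` with small coordinates
`ϑ_e = datVec ϑ e ∈ ℝ^D` (the datum is carried COLOUR-MAJOR, `ϑ : Fin D → (ZdEdge 4 → ℝ)`, as the interfaces `KernelMeanExpansionG` /
`KernelCovExpansionG` and the `SU(2)` datum package do), `ϑ = 0` on the temporal forest.  In the temporal-forest gauge the quadratic part of the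
action is then, colour by colour, the pinned lattice Maxwell form of the enlarged box with the SCALED datum `ϑ'_c = √β·ϑ_c` as pinned values,
whose Gaussian is the translate of D1' by the harmonic mean shift `μ'_c = mean ϑ'_c`.  Objects:

* `datVec ϑ e` — the coordinate vector `(ϑ c e)_c ∈ ℝ^D` of the edge `e`; `datVec 0 = 0`, `‖datVec ϑ e‖² = Σ_c (ϑ c e)²`;
* `sdatE β ϑ c = √β • ϑ c` — the scaled datum (Dirichlet units); `meanTE H D β ϑ : TSpaceD H D` — the colour tuple of harmonic mean shifts;
* `chartCfgDE ρ ϑ w` — the chart configuration of free-link chart data `w` with exterior datum `ϑ` (`ψ(extDatum (datVec ϑ) w e)`: free links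
  `ψ(w_e)`, forest links `1`, exterior links `ψ(ϑ_e)`); it IS the glued configuration `glueWith Λ (coldExt₁ (ψ ∘ w)) W` when `W = ψ(ϑ_·)` off
  the box (`glueWith_coldExt₁_expChart_datum`); `chartCfgDE ρ 0 = chartCfgE ρ`;
* `cfgTDE ρ H β ϑ t = chartCfgDE ρ ϑ (unscaleTE H D β (t + μ'))` — **the chart configuration with datum** of the CENTRED colour tuple `t` (the
  mean shift sits INSIDE the configuration; the Gaussian reference stays the unshifted `gaussD H D`); `cfgTDE ρ H β 0 = cfgTE ρ H β`;
* `qObsDE H D β ϑ p t = ½ Σ_c sCirc(glue ϑ'_c (mean ϑ'_c + t_c))(p)²` — the quadratic surrogate of `β·cost_p` with datum; `qObsDE H D β 0 = qObsD H D`;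
  in the cores' form `qObsDE p t = ½Σ_c (F_c(p) + dirCirc H p (t c))²`, `F_c(p) = sCirc(glue ϑ'_c (mean ϑ'_c))(p)` (`qObsDE_eq_half_sum_sq`);
* `goodTDE ρ H β ε ϑ` — the small-field event read in the centred variables; `tiltWDE ρ H g β ϑ` — the tilt exponent with datum (surrogate
  minus `β`·cost over the plaquettes touching `Λ`, plus `Σ_e log g(a_e)` for a chart density `g`, a PARAMETER as in `tiltWE`); both reduce
  to `goodTE` / `tiltWE` at `ϑ = 0`;
* elementary API (values on free / forest / exterior edges) and measurability.
Definitions + elementary lemmas only; no analysis.  No sorry; standard axioms.  NOT a claim about the mass gap: the crux is rung-level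
support (R2xi-G `XiPow`, RECORD label) and the Yang–Mills mass gap is NOT proved by any of this.
-/

set_option autoImplicit false

noncomputable section

open MeasureTheory Finset
open Literature.Probability.LatticeModels (Site)
open Literature.MathematicalPhysics.QuantumLattice
open Literature.MathematicalPhysics.QuantumFieldTheory
open Literature.MathematicalPhysics.QuantumFieldTheory.LatticeMaxwell
open Literature.MathematicalPhysics.QuantumFieldTheory.AxialGauge
open Summit.QuantumFields.YangMills.Theorems.WeakCouplingRates
open Summit.QuantumFields.YangMills.Theorems.FreeEnergyLogCoefficient

namespace Summit.QuantumFields.YangMills.Theorems.ColdBoxAllGroups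

variable {N : ℕ} {G : Type*} [Group G] (ρ : G →* Matrix (Fin N) (Fin N) ℂ) {H : ℕ}

/-! ## The coordinate vector of an edge and measurability of `extDatum` -/

/-- **The coordinate vector of the edge `e`** of a colour-major datum `ϑ`: `datVec ϑ e = (ϑ c e)_{c<D} ∈ ℝ^D`. -/
def datVec {D : ℕ} (ϑ : Fin D → (Literature.MathematicalPhysics.QuantumLattice.ZdEdge 4 → ℝ))
    (e : Literature.MathematicalPhysics.QuantumLattice.ZdEdge 4) : EuclideanSpace ℝ (Fin D) :=
  WithLp.toLp 2 fun c => ϑ c e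

/-- A component of the coordinate vector. -/
@[simp] theorem datVec_apply {D : ℕ} (ϑ : Fin D → (Literature.MathematicalPhysics.QuantumLattice.ZdEdge 4 → ℝ))
    (e : Literature.MathematicalPhysics.QuantumLattice.ZdEdge 4) (c : Fin D) : datVec ϑ e c = ϑ c e := rfl

/-- The flat datum has zero coordinate vectors. -/
@[simp] theorem datVec_zero {D : ℕ} : datVec (0 : Fin D → (Literature.MathematicalPhysics.QuantumLattice.ZdEdge 4 → ℝ)) = 0 := by
  funext e; ext c; rfl

/-- A datum vanishing at `e` has zero coordinate vector there. -/
theorem datVec_eq_zero_of {D : ℕ} (ϑ : Fin D → (Literature.MathematicalPhysics.QuantumLattice.ZdEdge 4 → ℝ))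
    {e : Literature.MathematicalPhysics.QuantumLattice.ZdEdge 4} (h : ∀ c, ϑ c e = 0) : datVec ϑ e = 0 := by
  ext c; exact h c

/-- `‖datVec ϑ e‖² = Σ_c (ϑ c e)²`. -/
theorem norm_datVec_sq {D : ℕ} (ϑ : Fin D → (Literature.MathematicalPhysics.QuantumLattice.ZdEdge 4 → ℝ))
    (e : Literature.MathematicalPhysics.QuantumLattice.ZdEdge 4) : ‖datVec ϑ e‖ ^ 2 = ∑ c, ϑ c e ^ 2 := by
  rw [EuclideanSpace.norm_eq, Real.sq_sqrt (Finset.sum_nonneg fun c _ => by positivity)]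
  exact Finset.sum_congr rfl fun c _ => by rw [datVec_apply, Real.norm_eq_abs, sq_abs]

/-- `‖datVec ϑ e‖ ≤ r` from `Σ_c (ϑ c e)² ≤ r²`, `r ≥ 0`. -/
theorem norm_datVec_le {D : ℕ} (ϑ : Fin D → (Literature.MathematicalPhysics.QuantumLattice.ZdEdge 4 → ℝ))
    {e : Literature.MathematicalPhysics.QuantumLattice.ZdEdge 4} {r : ℝ} (hr : 0 ≤ r) (h : ∑ c, ϑ c e ^ 2 ≤ r ^ 2) :
    ‖datVec ϑ e‖ ≤ r := by
  have h2 : ‖datVec ϑ e‖ ^ 2 ≤ r ^ 2 := by rw [norm_datVec_sq]; exact h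
  exact (pow_le_pow_iff_left₀ (norm_nonneg _) hr two_ne_zero).1 h2

/-- `extDatum ϑ` is measurable in the free-link data (any measurable structure on the values; the datum being fixed). -/
theorem measurable_extDatumE {V : Type*} [Zero V] [MeasurableSpace V] (ϑ : Literature.MathematicalPhysics.QuantumLattice.ZdEdge 4 → V)
    (e : Literature.MathematicalPhysics.QuantumLattice.ZdEdge 4) : Measurable fun w : ColdFreeIdx H → V => extDatum ϑ w e := by
  unfold extDatum
  split_ifs
  · exact measurable_const
  · exact measurable_pi_apply _
  · exact measurable_const

/-! ## The scaled datum and its harmonic mean shift (`√β` units) -/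

/-- **The scaled datum** `ϑ'_c = √β · ϑ_c` (Dirichlet units of the exponential chart: `t = √β·a`), colour by colour. -/
def sdatE {D : ℕ} (β : ℝ) (ϑ : Fin D → (Literature.MathematicalPhysics.QuantumLattice.ZdEdge 4 → ℝ)) :
    Fin D → (Literature.MathematicalPhysics.QuantumLattice.ZdEdge 4 → ℝ) := fun c => Real.sqrt β • ϑ c

/-- `sdatE β ϑ c e = √β · ϑ c e`. -/
@[simp] theorem sdatE_apply {D : ℕ} (β : ℝ) (ϑ : Fin D → (Literature.MathematicalPhysics.QuantumLattice.ZdEdge 4 → ℝ)) (c : Fin D)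
    (e : Literature.MathematicalPhysics.QuantumLattice.ZdEdge 4) : sdatE β ϑ c e = Real.sqrt β * ϑ c e := rfl

/-- `sdatE β ϑ c = √β • ϑ c` (definitional). -/
theorem sdatE_eq_smul {D : ℕ} (β : ℝ) (ϑ : Fin D → (Literature.MathematicalPhysics.QuantumLattice.ZdEdge 4 → ℝ)) (c : Fin D) :
    sdatE β ϑ c = Real.sqrt β • ϑ c := rfl

/-- The flat datum scales to the flat datum. -/
@[simp] theorem sdatE_zero {D : ℕ} (β : ℝ) : sdatE β (0 : Fin D → (Literature.MathematicalPhysics.QuantumLattice.ZdEdge 4 → ℝ)) = 0 := by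
  funext c; simp [sdatE]

/-- **The harmonic mean shift of the scaled datum**, as a colour tuple of D1' variables: `(mean ϑ'_c)_{c<D}`. -/
def meanTE (H D : ℕ) (β : ℝ) (ϑ : Fin D → (Literature.MathematicalPhysics.QuantumLattice.ZdEdge 4 → ℝ)) : TSpaceD H D :=
  fun c => WithLp.toLp 2 (mean (fun e => e ∉ dirFreeEdges H) dirCorner (2 * H + 3) (sdatE β ϑ c))

/-- `meanTE` of the flat datum vanishes. -/
@[simp] theorem meanTE_zero (D : ℕ) (β : ℝ) :
    meanTE H D β (0 : Fin D → (Literature.MathematicalPhysics.QuantumLattice.ZdEdge 4 → ℝ)) = 0 := by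
  funext c
  simp only [meanTE, sdatE_zero, Pi.zero_apply, mean_zero_dir]
  rfl

/-- Reading a component of `meanTE`. -/
theorem meanTE_apply (D : ℕ) (β : ℝ) (ϑ : Fin D → (Literature.MathematicalPhysics.QuantumLattice.ZdEdge 4 → ℝ)) (c : Fin D) :
    WithLp.ofLp (meanTE H D β ϑ c) = mean (fun e => e ∉ dirFreeEdges H) dirCorner (2 * H + 3) (sdatE β ϑ c) := rfl

/-- Translation by a fixed colour tuple is measurable on `TSpaceD H D` (componentwise). -/
theorem measurable_add_const_TSpaceD (D : ℕ) (m : TSpaceD H D) : Measurable fun t : TSpaceD H D => t + m := by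
  refine measurable_pi_lambda _ fun c => ?_
  change Measurable fun t : TSpaceD H D => t c + m c
  exact (measurable_pi_apply c).add_const _

/-! ## The chart configuration with datum -/

/-- **The chart configuration of free-link chart data `w` with datum `ϑ`** (exponential chart of `ρ`): every link of `ℤ⁴` is the chart point
`ψ(extDatum (datVec ϑ) w e)` — free links `ψ(w_e)`, forest links `ψ 0 = 1`, exterior links `ψ(ϑ_e)`; the ϑ-twin of `chartCfgE ρ w`. -/
def chartCfgDE (ϑ : Fin (dimE ρ) → (Literature.MathematicalPhysics.QuantumLattice.ZdEdge 4 → ℝ))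
    (w : ColdFreeIdx H → EuclideanSpace ℝ (Fin (dimE ρ))) : LGConfig 4 G :=
  fun e => expChart ρ (extDatum (datVec ϑ) w e)

/-- `chartCfgDE` unfolded at an edge (definitional). -/
theorem chartCfgDE_apply (ϑ : Fin (dimE ρ) → (Literature.MathematicalPhysics.QuantumLattice.ZdEdge 4 → ℝ))
    (w : ColdFreeIdx H → EuclideanSpace ℝ (Fin (dimE ρ))) (e : Literature.MathematicalPhysics.QuantumLattice.ZdEdge 4) :
    chartCfgDE ρ ϑ w e = expChart ρ (extDatum (datVec ϑ) w e) := rfl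

/-- At the flat datum, `chartCfgDE ρ 0 = chartCfgE ρ`. -/
@[simp] theorem chartCfgDE_zero :
    chartCfgDE (H := H) ρ (0 : Fin (dimE ρ) → (Literature.MathematicalPhysics.QuantumLattice.ZdEdge 4 → ℝ)) = chartCfgE ρ := by
  funext w e
  rw [chartCfgDE_apply, datVec_zero, extDatum_zero]
  rfl

/-- Off the cold box `chartCfgDE ρ ϑ w` is the chart point of the datum. -/
theorem chartCfgDE_of_not_mem (ϑ : Fin (dimE ρ) → (Literature.MathematicalPhysics.QuantumLattice.ZdEdge 4 → ℝ))
    (w : ColdFreeIdx H → EuclideanSpace ℝ (Fin (dimE ρ))) {e : Literature.MathematicalPhysics.QuantumLattice.ZdEdge 4}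
    (he : e ∉ boxEdges 4 (2 * H + 1)) : chartCfgDE ρ ϑ w e = expChart ρ (datVec ϑ e) := by
  rw [chartCfgDE_apply, extDatum_of_not_mem _ _ he]

/-- On an edge of the cold box (free or forest) `chartCfgDE ρ ϑ w` does not read the datum: it is `chartCfgE ρ w` there. -/
theorem chartCfgDE_of_mem (ϑ : Fin (dimE ρ) → (Literature.MathematicalPhysics.QuantumLattice.ZdEdge 4 → ℝ))
    (w : ColdFreeIdx H → EuclideanSpace ℝ (Fin (dimE ρ))) {e : Literature.MathematicalPhysics.QuantumLattice.ZdEdge 4}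
    (he : e ∈ boxEdges 4 (2 * H + 1)) : chartCfgDE ρ ϑ w e = chartCfgE ρ w e := by
  rw [chartCfgDE_apply, extDatum_of_mem _ _ he, chartCfgE_apply]

/-- On a free link `chartCfgDE ρ ϑ w` is the chart point `ψ(w_e)`. -/
theorem chartCfgDE_apply_free (ϑ : Fin (dimE ρ) → (Literature.MathematicalPhysics.QuantumLattice.ZdEdge 4 → ℝ))
    (w : ColdFreeIdx H → EuclideanSpace ℝ (Fin (dimE ρ))) (e : ColdFreeIdx H) : chartCfgDE ρ ϑ w e.1.1 = expChart ρ (w e) := by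
  rw [chartCfgDE_apply, extDatum_apply_free]

section Chart

variable [TopologicalSpace G] [CompactSpace G]

/-- On the temporal forest `chartCfgDE ρ ϑ w` is `1` (faithful continuous `ρ`). -/
theorem chartCfgDE_of_forest (hρ : Continuous ρ) (hinj : Function.Injective ρ)
    (ϑ : Fin (dimE ρ) → (Literature.MathematicalPhysics.QuantumLattice.ZdEdge 4 → ℝ))
    (w : ColdFreeIdx H → EuclideanSpace ℝ (Fin (dimE ρ))) {x : Site 4} (hx : ∀ k : Fin 4, 1 ≤ x k ∧ x k + 1 ≤ 2 * (H : ℤ)) :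
    chartCfgDE ρ ϑ w (x, 0) = 1 := by
  rw [chartCfgDE_apply, extDatum_of_forest _ _ hx, expChart_zero ρ hρ hinj]

/-- **Gluing gauge-fixed free links into the datum gives the chart configuration with datum**: if the exterior configuration `W` is
`ψ(ϑ_e)` off the cold box, then `glueWith Λ (coldExt₁ (ψ ∘ w)) W = chartCfgDE ρ ϑ w` (faithful continuous `ρ`). -/
theorem glueWith_coldExt₁_expChart_datum (hρ : Continuous ρ) (hinj : Function.Injective ρ)
    (ϑ : Fin (dimE ρ) → (Literature.MathematicalPhysics.QuantumLattice.ZdEdge 4 → ℝ)) {W : LGConfig 4 G}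
    (hW : ∀ e, e ∉ boxEdges 4 (2 * H + 1) → W e = expChart ρ (datVec ϑ e)) (w : ColdFreeIdx H → EuclideanSpace ℝ (Fin (dimE ρ))) :
    Literature.Probability.LatticeModels.glueWith (boxEdges 4 (2 * H + 1)) (coldExt₁ (fun e => expChart ρ (w e))) W =
      chartCfgDE ρ ϑ w := by
  funext e
  by_cases he : e ∈ boxEdges 4 (2 * H + 1)
  · have h2 := coldExt_apply_mem (coldExt₁ (fun e => expChart ρ (w e))) ⟨e, he⟩
    rw [coldExt_coldExt₁_expChart ρ hρ hinj] at h2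
    rw [Literature.Probability.LatticeModels.glueWith_apply_mem _ _ _ he, chartCfgDE_of_mem ρ _ _ he, ← h2]
  · rw [Literature.Probability.LatticeModels.glueWith_apply_not_mem _ _ _ he, hW e he, chartCfgDE_of_not_mem ρ _ _ he]

/-- `chartCfgDE ρ ϑ` is measurable in the free-link data. -/
theorem measurable_chartCfgDE [MeasurableSpace G] [BorelSpace G] (hρ : Continuous ρ) (hinj : Function.Injective ρ)
    (ϑ : Fin (dimE ρ) → (Literature.MathematicalPhysics.QuantumLattice.ZdEdge 4 → ℝ)) :
    Measurable (chartCfgDE (H := H) ρ ϑ) :=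
  measurable_pi_lambda _ fun e => (measurable_expChart ρ hρ hinj).comp (measurable_extDatumE _ e)

end Chart

/-! ## The chart configuration with datum of a centred colour tuple -/

variable (H) in
/-- **The chart configuration with datum** of the CENTRED colour tuple `t`: every link of `ℤ⁴` is the exponential-chart point of
`extDatum (datVec ϑ) ((t + μ')/√β)`, i.e. free links `ψ((t + μ')_e/√β)`, forest links `1`, exterior links `ψ(ϑ_e)`:
`cfgTDE ρ H β ϑ t = chartCfgDE ρ ϑ (unscaleTE H D β (t + meanTE H D β ϑ))`, `D = dimE ρ`. -/
def cfgTDE (β : ℝ) (ϑ : Fin (dimE ρ) → (Literature.MathematicalPhysics.QuantumLattice.ZdEdge 4 → ℝ)) (t : TSpaceD H (dimE ρ)) :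
    LGConfig 4 G :=
  chartCfgDE ρ ϑ (unscaleTE H (dimE ρ) β (t + meanTE H (dimE ρ) β ϑ))

/-- `cfgTDE` through `chartCfgDE` (definitional). -/
theorem cfgTDE_eq_chartCfgDE (β : ℝ) (ϑ : Fin (dimE ρ) → (Literature.MathematicalPhysics.QuantumLattice.ZdEdge 4 → ℝ))
    (t : TSpaceD H (dimE ρ)) : cfgTDE ρ H β ϑ t = chartCfgDE ρ ϑ (unscaleTE H (dimE ρ) β (t + meanTE H (dimE ρ) β ϑ)) := rfl

/-- `cfgTDE` unfolded at an edge (definitional). -/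
theorem cfgTDE_apply (β : ℝ) (ϑ : Fin (dimE ρ) → (Literature.MathematicalPhysics.QuantumLattice.ZdEdge 4 → ℝ))
    (t : TSpaceD H (dimE ρ)) (e : Literature.MathematicalPhysics.QuantumLattice.ZdEdge 4) :
    cfgTDE ρ H β ϑ t e = expChart ρ (extDatum (datVec ϑ) (unscaleTE H (dimE ρ) β (t + meanTE H (dimE ρ) β ϑ)) e) := rfl

/-- **At the flat datum the chart configuration with datum is the flat one**: `cfgTDE ρ H β 0 = cfgTE ρ H β`. -/
@[simp] theorem cfgTDE_zero (β : ℝ) :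
    cfgTDE ρ H β (0 : Fin (dimE ρ) → (Literature.MathematicalPhysics.QuantumLattice.ZdEdge 4 → ℝ)) = cfgTE ρ H β := by
  funext t
  rw [cfgTDE_eq_chartCfgDE, meanTE_zero, add_zero, chartCfgDE_zero, cfgTE_eq]

/-- Off the cold box the chart configuration with datum is the chart point of the datum. -/
theorem cfgTDE_of_not_mem (β : ℝ) (ϑ : Fin (dimE ρ) → (Literature.MathematicalPhysics.QuantumLattice.ZdEdge 4 → ℝ))
    (t : TSpaceD H (dimE ρ)) {e : Literature.MathematicalPhysics.QuantumLattice.ZdEdge 4} (he : e ∉ boxEdges 4 (2 * H + 1)) :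
    cfgTDE ρ H β ϑ t e = expChart ρ (datVec ϑ e) := by
  rw [cfgTDE_eq_chartCfgDE, chartCfgDE_of_not_mem ρ _ _ he]

/-- On the temporal forest the chart configuration with datum is `1`. -/
theorem cfgTDE_of_forest [TopologicalSpace G] [CompactSpace G] (hρ : Continuous ρ) (hinj : Function.Injective ρ) (β : ℝ)
    (ϑ : Fin (dimE ρ) → (Literature.MathematicalPhysics.QuantumLattice.ZdEdge 4 → ℝ)) (t : TSpaceD H (dimE ρ))
    {x : Site 4} (hx : ∀ k : Fin 4, 1 ≤ x k ∧ x k + 1 ≤ 2 * (H : ℤ)) : cfgTDE ρ H β ϑ t (x, 0) = 1 := by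
  rw [cfgTDE_eq_chartCfgDE, chartCfgDE_of_forest ρ hρ hinj _ _ hx]

/-- On a free link the chart configuration with datum is the chart point of the shifted, unscaled variable. -/
theorem cfgTDE_apply_free (β : ℝ) (ϑ : Fin (dimE ρ) → (Literature.MathematicalPhysics.QuantumLattice.ZdEdge 4 → ℝ))
    (t : TSpaceD H (dimE ρ)) (e : ColdFreeIdx H) :
    cfgTDE ρ H β ϑ t e.1.1 = expChart ρ (unscaleTE H (dimE ρ) β (t + meanTE H (dimE ρ) β ϑ) e) := by
  rw [cfgTDE_eq_chartCfgDE, chartCfgDE_apply_free]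

/-- On an edge of the cold box the chart configuration with datum is the FLAT chart configuration of the shifted tuple:
`cfgTDE ρ H β ϑ t e = cfgTE ρ H β (t + μ') e`. -/
theorem cfgTDE_of_mem (β : ℝ) (ϑ : Fin (dimE ρ) → (Literature.MathematicalPhysics.QuantumLattice.ZdEdge 4 → ℝ))
    (t : TSpaceD H (dimE ρ)) {e : Literature.MathematicalPhysics.QuantumLattice.ZdEdge 4} (he : e ∈ boxEdges 4 (2 * H + 1)) :
    cfgTDE ρ H β ϑ t e = cfgTE ρ H β (t + meanTE H (dimE ρ) β ϑ) e := by
  rw [cfgTDE_eq_chartCfgDE, chartCfgDE_of_mem ρ _ _ he, cfgTE_eq]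

/-- `cfgTDE` is measurable in the centred variables. -/
theorem measurable_cfgTDE [TopologicalSpace G] [CompactSpace G] [MeasurableSpace G] [BorelSpace G] (hρ : Continuous ρ)
    (hinj : Function.Injective ρ) (β : ℝ) (ϑ : Fin (dimE ρ) → (Literature.MathematicalPhysics.QuantumLattice.ZdEdge 4 → ℝ)) :
    Measurable (cfgTDE ρ H β ϑ) :=
  (measurable_chartCfgDE ρ hρ hinj ϑ).comp ((measurable_unscaleTE _ β).comp (measurable_add_const_TSpaceD _ _))

/-! ## The quadratic surrogate with datum -/

/-- **The quadratic surrogate with datum** of `β·cost_p`, `D` colours: `½ Σ_c sCirc(glue ϑ'_c (mean ϑ'_c + t_c))(p)²` (the scaled datum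
`ϑ' = sdatE β ϑ` pinned on the enlarged box, the harmonic background plus the fluctuation on the free edges). -/
def qObsDE (H D : ℕ) (β : ℝ) (ϑ : Fin D → (Literature.MathematicalPhysics.QuantumLattice.ZdEdge 4 → ℝ)) (p : Plaq 4)
    (t : TSpaceD H D) : ℝ :=
  1 / 2 * ∑ c, (sCirc (glue (pin := fun e => e ∉ dirFreeEdges H) dirCorner (2 * H + 3) (sdatE β ϑ c)
    (mean (fun e => e ∉ dirFreeEdges H) dirCorner (2 * H + 3) (sdatE β ϑ c) + WithLp.ofLp (t c))) p) ^ 2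

/-- `qObsDE` is nonnegative. -/
theorem qObsDE_nonneg (D : ℕ) (β : ℝ) (ϑ : Fin D → (Literature.MathematicalPhysics.QuantumLattice.ZdEdge 4 → ℝ)) (p : Plaq 4)
    (t : TSpaceD H D) : 0 ≤ qObsDE H D β ϑ p t := by
  unfold qObsDE; positivity

/-- **At the flat datum the surrogate with datum is the flat one**: `qObsDE H D β 0 = qObsD H D`. -/
@[simp] theorem qObsDE_zero (D : ℕ) (β : ℝ) :
    qObsDE H D β (0 : Fin D → (Literature.MathematicalPhysics.QuantumLattice.ZdEdge 4 → ℝ)) = qObsD H D := by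
  funext p t
  simp only [qObsDE, qObsD, sdatE_zero, Pi.zero_apply, mean_zero_dir, zero_add, dirCirc_apply]

/-- **`qObsDE` in the cores' form**: `qObsDE H D β ϑ p t = ½Σ_c (F_c(p) + dirCirc H p (t c))²` with the (scaled) background circulations
`F_c(p) = sCirc (glue ϑ'_c (mean ϑ'_c)) p` (the circulation is affine in the free variables). -/
theorem qObsDE_eq_half_sum_sq (D : ℕ) (β : ℝ) (ϑ : Fin D → (Literature.MathematicalPhysics.QuantumLattice.ZdEdge 4 → ℝ)) (p : Plaq 4)
    (t : TSpaceD H D) :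
    qObsDE H D β ϑ p t = 1 / 2 * ∑ c, (sCirc (glue (pin := fun e => e ∉ dirFreeEdges H) dirCorner (2 * H + 3) (sdatE β ϑ c)
      (mean (fun e => e ∉ dirFreeEdges H) dirCorner (2 * H + 3) (sdatE β ϑ c))) p + dirCirc H p (t c)) ^ 2 := by
  unfold qObsDE
  congr 1
  exact Finset.sum_congr rfl fun c _ => by rw [sCirc_glue_add_ofLp]

/-- `qObsDE` is measurable. -/
theorem measurable_qObsDE (D : ℕ) (β : ℝ) (ϑ : Fin D → (Literature.MathematicalPhysics.QuantumLattice.ZdEdge 4 → ℝ)) (p : Plaq 4) :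
    Measurable (qObsDE H D β ϑ p) := by
  unfold qObsDE
  exact measurable_const.mul (Finset.measurable_sum _ fun c _ =>
    ((measurable_sCirc_glue_add _ _ p).comp (measurable_pi_apply c)).pow_const 2)

/-! ## The small-field event and the tilt, with datum -/

variable (H) in
/-- **The small-field event read in the centred colour variables, with datum**: `cfgTDE ρ H β ϑ t ∈ coldGoodSetG ρ H β ε`. -/
def goodTDE (β ε : ℝ) (ϑ : Fin (dimE ρ) → (Literature.MathematicalPhysics.QuantumLattice.ZdEdge 4 → ℝ)) : Set (TSpaceD H (dimE ρ)) :=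
  {t | cfgTDE ρ H β ϑ t ∈ coldGoodSetG ρ H β ε}

/-- Membership in `goodTDE` (definitional). -/
theorem mem_goodTDE_iff (β ε : ℝ) (ϑ : Fin (dimE ρ) → (Literature.MathematicalPhysics.QuantumLattice.ZdEdge 4 → ℝ))
    (t : TSpaceD H (dimE ρ)) : t ∈ goodTDE ρ H β ε ϑ ↔ cfgTDE ρ H β ϑ t ∈ coldGoodSetG ρ H β ε := Iff.rfl

/-- At the flat datum, `goodTDE = goodTE`. -/
@[simp] theorem goodTDE_zero (β ε : ℝ) :
    goodTDE ρ H β ε (0 : Fin (dimE ρ) → (Literature.MathematicalPhysics.QuantumLattice.ZdEdge 4 → ℝ)) = goodTE ρ H β ε := by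
  ext t; simp only [mem_goodTDE_iff, cfgTDE_zero, mem_goodTE_iff]

/-- `goodTDE` is measurable. -/
theorem measurableSet_goodTDE [TopologicalSpace G] [IsTopologicalGroup G] [CompactSpace G] [MeasurableSpace G] [BorelSpace G]
    [SecondCountableTopology G] (hρ : Continuous ρ) (hinj : Function.Injective ρ) (β ε : ℝ)
    (ϑ : Fin (dimE ρ) → (Literature.MathematicalPhysics.QuantumLattice.ZdEdge 4 → ℝ)) : MeasurableSet (goodTDE ρ H β ε ϑ) :=
  measurable_cfgTDE ρ hρ hinj β ϑ (measurableSet_coldGoodSetG ρ hρ β ε)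

variable (H) in
/-- **The tilt exponent with datum**: (quadratic surrogate with datum minus `β`·cost of the chart configuration with datum, summed over the
plaquettes touching the cold box) plus the logarithm of the normalised chart density `Π_{e free} g(a_e)` at the free links
`a = unscaleTE H D β (t + μ')` (`g` a parameter, produced by the representation file; `κE(r)^{−D} ≤ g ≤ 1` on chart balls). -/
def tiltWDE (g : EuclideanSpace ℝ (Fin (dimE ρ)) → ℝ) (β : ℝ) (ϑ : Fin (dimE ρ) → (Literature.MathematicalPhysics.QuantumLattice.ZdEdge 4 → ℝ))
    (t : TSpaceD H (dimE ρ)) : ℝ :=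
  (∑ q ∈ plaquettesTouching (boxEdges 4 (2 * H + 1)),
      (qObsDE H (dimE ρ) β ϑ (q.1, q.2.1.1, q.2.1.2) t - β * plaqCostAt ρ q.1 q.2.1.1 q.2.1.2 (cfgTDE ρ H β ϑ t))) +
    ∑ e : ColdFreeIdx H, Real.log (g (unscaleTE H (dimE ρ) β (t + meanTE H (dimE ρ) β ϑ) e))

/-- At the flat datum, `tiltWDE = tiltWE`. -/
@[simp] theorem tiltWDE_zero (g : EuclideanSpace ℝ (Fin (dimE ρ)) → ℝ) (β : ℝ) :
    tiltWDE ρ H g β (0 : Fin (dimE ρ) → (Literature.MathematicalPhysics.QuantumLattice.ZdEdge 4 → ℝ)) = tiltWE ρ H g β := by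
  funext t
  simp only [tiltWDE, tiltWE, qObsDE_zero, cfgTDE_zero, meanTE_zero, add_zero]

/-- `tiltWDE` is measurable (measurable density `g`). -/
theorem measurable_tiltWDE [TopologicalSpace G] [IsTopologicalGroup G] [CompactSpace G] [MeasurableSpace G] [BorelSpace G]
    [SecondCountableTopology G] (hρ : Continuous ρ) (hinj : Function.Injective ρ)
    {g : EuclideanSpace ℝ (Fin (dimE ρ)) → ℝ} (hg : Measurable g) (β : ℝ)
    (ϑ : Fin (dimE ρ) → (Literature.MathematicalPhysics.QuantumLattice.ZdEdge 4 → ℝ)) : Measurable (tiltWDE ρ H g β ϑ) := by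
  unfold tiltWDE
  refine (Finset.measurable_sum _ fun q _ => (measurable_qObsDE _ β ϑ _).sub
    (measurable_const.mul ((measurable_plaqCostAt_of_continuous ρ hρ _ _ _).comp (measurable_cfgTDE ρ hρ hinj β ϑ)))).add
    (Finset.measurable_sum _ fun e _ => Real.measurable_log.comp (hg.comp ((measurable_pi_apply e).comp
      ((measurable_unscaleTE _ β).comp (measurable_add_const_TSpaceD _ _)))))

end Summit.QuantumFields.YangMills.Theorems.ColdBoxAllGroups

end
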